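import Summits.Langlands.Langlands.Theses.IrreducibilityBySelfDuality
import Summits.Langlands.Langlands.Theorems.HalfIntegralTwistCM.Negative.ModulusParallel
import Literature.NumberTheory.GaloisRepresentations.HeckeCharacterArchType
import Literature.NumberTheory.NumberFields.ChevalleyUnitCongruence

/-!
# Line `chevalley-exponent-saturation` — checked skeleton for crux `HalfIntegralTwistCM`
# (stmt-Langlands-14036, route `IrreducibilityBySelfDuality`, rank 4)

Crux (by name): `Summit.Langlands.Langlands.Theses.IrreducibilityBySelfDuality.HalfIntegralTwistCM` —
`K` CM; `s₁ s₂ : (K →+* ℂ) → ℂ` with (i) `s₁ - s₂ ∈ ℤ`, (ii) `s₁ ι - s₁ ῑ ∈ ℤ`, (iii)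
`(s₁-s₂) ι + (s₁-s₂) ῑ ∈ 2ℤ`, (iv) a `GL₁` datum `ω` of archimedean parameter `{s₁ ι + s₂ ι}` ⟹ a `GL₁`
datum `χ` of parameter `{p ι}` with `p ι + s₁ ι ∈ ½ + ℤ` at every `ι`.

## The line (idea card `Ideas/chevalley-exponent-saturation.md`, merged by triage with
## `torsion-blind-unit-criterion`; this skeleton is the "Chevalley(m := M) + Tate seed" consumer)

Write `e = s₁ + s₂`, `T_w = Im (e σ_w + e σ̄_w)`, `p = ½ - s₁ + N` (place-dependent flattening
integers `N` from (iii)), `n_w = p σ_w - p σ̄_w ∈ ℤ` (from (ii)). The twisting character has unitary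
archimedean type `(n, -T/2)` and real weight `(1 - σ_ω)/2`.

1. `stub_unitRelation` (READ = Weil NECESSITY in `archUnitaryValue` form, any totally complex `K`):
   Weil's unit product of type `(e σ_w - e σ̄_w, T)` has a uniform finite exponent `M₀` on ALL units.
2. LEVER (PROVED here, §2): over a CM field `(ι u/|ι u|)² = ι(u ū⁻¹)` is a root of unity (Mathlib
   `IsCMField.unitsMulComplexConjInv`), so the angular exponents are invisible at exponent `2 w_K`
   and the modulus exponent halves on positive reals: the HALF type `(n, -T/2)` has finite exponent
   `M₁` on ALL of `𝓞_Kˣ` — no `K⁺`, no unit index, no sign characters, no parity cases.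
3. `stub_chevalleyUnits` (ONE CHEVALLEY CALL with `m := M₁`; Chevalley 1951 Thm 1 for `E = 𝓞_Kˣ`):
   the `M₁`-th powers of units contain a congruence subgroup `U_a`; hence (§3, proved: the unit product
   is multiplicative) the half type is trivial on `U_a`.
4. `stub_weilExtension` (TATE SEED / Weil 1956 extension, congruence form, any `K`): a unitary
   archimedean type trivial on `U_a` is the type of a Hecke character `ψ`.
5. `stub_writeArchParam` (WRITE, any totally complex `K`): `π_{ψ‖·‖^r}` is a cuspidal `GL₁` datum of
   parameter `σ_w ↦ r + (n_w + i t_w)/2`, `σ̄_w ↦ r + (-n_w + i t_w)/2`.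
6. Bookkeeping (PROVED here, §5, after `IdeaSketch3.crux_of_classification`): (iii) gives the
   flattening integers, (ii) the integrality of `n`, `exists_re_archParam_parallel_glOne` (LANDED,
   `Negative/ModulusParallel`) the place-independence of `Re (p σ_w + p σ̄_w)`,
   `archParam_embedding_sub_conj_mem_int_glOne` (LANDED, `Negative/ArchParameterGLOne`) the angular
   integers of `ω`; hypothesis (i) is not used (Disproof F3(a)).

`HalfIntegralTwistCM_of` concludes the crux BY NAME from the four stubs; the composition
`crux_of_weilExistence` / `weilExistence_of_chevalley_extension` is sorry-free (axioms
`propext, Classical.choice, Quot.sound`). The torsion-blind branch of the same line is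
`weilExistence_of_patrikis` (the named fact `Patrikis2019_heckeCharacter_archType_iff_units` (⇐)
replaces stubs 3 + 4 of this list, i.e. `stub_chevalleyUnits` + `stub_weilExtension`).

## Disproof used (`Cruxes/HalfIntegralTwistCM/Disproof.lean`, gen 2)
F2 `halfIntegralTwistCM_false_without_conjInt` — (ii) is consumed in §5 (`hn`: integrality of the
angular integers `n_w` of the half twist). F4/F11 (`IsCMField` load-bearing, not weakenable to
`IsTotallyComplex`: `not_weilHypothesis_blind_of_isTotallyComplex`) — the lever §2 is stated and proved
under `[IsCMField K]` only. F6 ((iii) as uniform parity) — consumed by the flattening integers. F7 ((iv))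
— `ω` feeds `stub_unitRelation`. F9 (`not_halfIntegralTwistCMUniformShift`) — the shifts `N ι` are
place-dependent (`flatten_pair`). F3(c) (no unitary / real re-twist) — `t = -T/2` is kept place-dependent
and `r` real but `p` complex. F10b — `stub_unitRelation` is VERBATIM `unit_relation_weilForm_glOne`
(sorry-free in the Disproof workfile, not yet landed): port it. No stub is an instance of a landed
`Negative/` lemma (`ExactShift`, `WithoutConjInt`, `WithoutIsCMField`, `ParityAndDatum` refute
strengthenings / weakenings of the CRUX, none of which is a stub here; stubs 1, 3, 4, 5 do not mention
`s₁, s₂` at all).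
-/

set_option linter.dupNamespace false
set_option linter.unusedVariables false

noncomputable section

namespace Summit.Langlands.Langlands.Cruxes.HalfIntegralTwistCM.ChevalleyExponentSaturation

open NumberField NumberField.Units NumberField.InfinitePlace NumberField.ComplexEmbedding
open Literature.NumberTheory.GaloisRepresentations
open Literature.NumberTheory.Automorphic
open Summit.Langlands.Langlands.Theorems.HalfIntegralTwistCM.Negative
open scoped ComplexConjugate NumberField Classical

/-- The crux under attack (a local ABBREVIATION, used only by the sorry-free composition lemmas;
the registered skeleton theorem `HalfIntegralTwistCM_of` below concludes the route decl BY NAME). -/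
abbrev Crux : Prop :=
  Summit.Langlands.Langlands.Theses.IrreducibilityBySelfDuality.HalfIntegralTwistCM

/-! ## §1 The four registered stubs -/

/-- **STUB 1 — READ: Weil's unit relation for a `GL₁` datum, in `archUnitaryValue` form (necessity half
of Weil's unit criterion; any TOTALLY COMPLEX number field; no named fact).** If a cuspidal `GL₁` datum
`ω` has archimedean parameter `ι ↦ {e ι}` and `e σ_w - e σ̄_w = m_w ∈ ℤ`, then for one `M ≥ 1` and all
global units `α`, `(∏_w (σ_w α/|σ_w α|)^{m_w} |σ_w α|^{i·Im(e σ_w + e σ̄_w)})^M = 1`.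
Size M. PROVED VERBATIM as `unit_relation_weilForm_glOne` in `Cruxes/HalfIntegralTwistCM/Disproof.lean`
§10b (level of `χ_ω` + `exists_unit_pow_sub_one_mem` + the exponential formula for `θ_∞` + parallel real
weights + product formula) — port it under `Theorems/`. Patrikis 2019 = arXiv:1207.6724, Lemma 2.1.1 (⇒);
Weil 1956. -/
theorem stub_unitRelation (K : Type) [Field K] [NumberField K] [IsTotallyComplex K]
    (h1 : isCompact_glFiniteIntegralLevel 1 K) (ω : CuspidalAutomorphicRepData 1 K h1)
    (e : (K →+* ℂ) → ℂ) (hω : ω.1.HasArchParameter (fun ι => {e ι}))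
    (me : InfinitePlace K → ℤ)
    (hme : ∀ w : InfinitePlace K, e w.embedding - e (ComplexEmbedding.conjugate w.embedding) = me w) :
    ∃ M : ℕ, 0 < M ∧ ∀ α : (𝓞 K)ˣ,
      (∏ w : InfinitePlace K, archUnitaryValue (me w)
        ((e w.embedding + e (ComplexEmbedding.conjugate w.embedding)).im) (w.embedding ((α : 𝓞 K) : K))) ^ M = 1 := by
  sorry

/-- **STUB 2 — ONE CHEVALLEY CALL (Chevalley 1951, Théorème 1, for `E = 𝓞_Kˣ` and exponent `M`; the
HARDEST stub).** For every number field `K` and every `M ≥ 1` there is a rational modulus `a ≥ 1` such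
that every unit `u ≡ 1 (mod a)` is the `M`-th power of a unit: the `M`-th powers contain the congruence
subgroup `U_a`. Size L from scratch (reduction to prime-power `M`; Kummer theory of `K(ζ_{ℓ^b}, E^{1/ℓ^b})`
+ Chebotarev — `chebotarev_artinRep_holds` is PROVED in the tree; Chevalley's `-1/2`-square-class caveat
at `ℓ = 2`, Remarque p. 39); ONE LINE from the accepted named fact `Chevalley1951.thm1_units`
(`chevalleyUnits_of_thm1_units` below). By the necessity note (`NecessityTwoPowerChevalley.md`) a
Chevalley-class input is unavoidable on this crux; this line calls it ONCE, with the explicit exponent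
`M₁ = 2·w_K·2·M₀` of §2, on the FULL unit group. doi:10.2969/jmsj/00310036, Thm 1 (p. 36). -/
theorem stub_chevalleyUnits (K : Type) [Field K] [NumberField K] (M : ℕ) (hM : 0 < M) :
    ∃ a : ℕ, 0 < a ∧ ∀ u : (𝓞 K)ˣ, (a : 𝓞 K) ∣ (u : 𝓞 K) - 1 → ∃ v : (𝓞 K)ˣ, u = v ^ M := by
  sorry

/-- **STUB 3 — TATE SEED / WEIL EXTENSION in congruence form (any number field; no Chevalley inside).**
If the unitary archimedean type `(m, t)` is trivial on the congruence units `u ≡ 1 (mod a)`, then it is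
the archimedean type of a Hecke character: `ψ((x, 1)) = ∏_w (ι_w x_w/|ι_w x_w|)^{m_w} |ι_w x_w|^{i t_w}`.
Proof line: `χ_∞ := ∏_w archUnitaryValue (m_w) (t_w) ∘ ι_w` is a continuous character of `(K ⊗ ℝ)ˣ`
whose value on a global unit is the unit product (`extensionEmbedding_coe`); `Kˣ ∩ (K_∞ˣ × Û_a) = U_a`,
so `χ₀(k·(x, y)) := χ_∞(x)` is well defined on the OPEN finite-index subgroup `Kˣ·(K_∞ˣ × Û_a)` of `𝕀_K`
(quotient = ray class group mod `a`), trivial on `Kˣ`; extend into the divisible group `ℂˣ`; continuity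
from openness. Template in tree: `HeckeCharacter.exists_of_isRayClassCharacter` (HeckeCharacterOfRayClass).
Size M. Shared with cards two-primary-chevalley-core (stub A2
`ExistsHeckeCharacterOfArchCharTrivialOnCongruenceUnits`, general continuous `f`) and tate-seed-transplant
(`tateSeed`): this is their specialisation to `f = unitaryArchChar m t` (+ its continuity).
Cassels–Fröhlich Ch. VII §4 Prop. 4.1; Weil 1956; Patrikis 2019 Lemma 2.1.1 (⇐, extension half). -/
theorem stub_weilExtension (K : Type) [Field K] [NumberField K]
    (m : InfinitePlace K → ℤ) (t : InfinitePlace K → ℝ) (a : ℕ) (ha : 0 < a)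
    (h : ∀ u : (𝓞 K)ˣ, (a : 𝓞 K) ∣ (u : 𝓞 K) - 1 →
      ∏ w : InfinitePlace K, archUnitaryValue (m w) (t w) (w.embedding ((u : 𝓞 K) : K)) = 1) :
    ∃ ψ : HeckeCharacter K, ψ.HasUnitaryArchType m t := by
  sorry

/-- **STUB 4 — WRITE: the `GL₁` datum of `ψ·‖·‖^r` and its archimedean parameter (any TOTALLY COMPLEX
number field).** If `ψ` has unitary archimedean type `(m, t)` and `r ∈ ℝ`, some cuspidal `GL₁` datum has
archimedean parameter `σ_w ↦ {r + (m_w + i t_w)/2}`, `σ̄_w ↦ {r + (-m_w + i t_w)/2}` (these two values at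
the two embeddings of each place determine `P`). Proof line: `π_ψ` (`exists_automorphicRepData_detTwist_glOne`
/ `exists_cuspidal_glOne_hasSatakeParamAt_valueAtUniformizer`; every `GL₁` datum has a parameter,
`exists_hasArchParameter_glOne`) has parameter `((±m_w + i t_w)/2)` by the LANDED
`archParam_of_hasUnitaryArchType` (`Negative/ModulusParallel`); twisting by `‖·‖^r`
(`exists_heckeCharacter_ideleNorm_cpow`, `HasArchParameter.of_map_mulChar_detTwist`, real `r`) adds `r` at
every embedding. Size S–M (assembly of proved tree theorems; the id/conj convention at `σ̄_w` is the one
point to watch). Tate 1950 §2.3; Patrikis 2019 §2.1. -/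
theorem stub_writeArchParam (K : Type) [Field K] [NumberField K] [IsTotallyComplex K]
    (h1 : isCompact_glFiniteIntegralLevel 1 K) (ψ : HeckeCharacter K)
    (m : InfinitePlace K → ℤ) (t : InfinitePlace K → ℝ) (hψ : ψ.HasUnitaryArchType m t) (r : ℝ)
    (P : (K →+* ℂ) → ℂ)
    (hP : ∀ w : InfinitePlace K, P w.embedding = r + ((m w : ℂ) + t w * Complex.I) / 2)
    (hP' : ∀ w : InfinitePlace K,
      P (ComplexEmbedding.conjugate w.embedding) = r + (-(m w : ℂ) + t w * Complex.I) / 2) :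
    ∃ χ : CuspidalAutomorphicRepData 1 K h1, χ.1.HasArchParameter (fun ι => {P ι}) := by
  sorry

/-! ### The stub statements as named propositions (for the sorry-free composition lemmas) -/

/-- Statement of `stub_unitRelation`. -/
def UnitRelation : Prop :=
  ∀ (K : Type) [Field K] [NumberField K] [IsTotallyComplex K]
    (h1 : isCompact_glFiniteIntegralLevel 1 K) (ω : CuspidalAutomorphicRepData 1 K h1)
    (e : (K →+* ℂ) → ℂ), ω.1.HasArchParameter (fun ι => {e ι}) →
    ∀ (me : InfinitePlace K → ℤ),
      (∀ w : InfinitePlace K, e w.embedding - e (ComplexEmbedding.conjugate w.embedding) = me w) →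
      ∃ M : ℕ, 0 < M ∧ ∀ α : (𝓞 K)ˣ,
        (∏ w : InfinitePlace K, archUnitaryValue (me w)
          ((e w.embedding + e (ComplexEmbedding.conjugate w.embedding)).im) (w.embedding ((α : 𝓞 K) : K))) ^ M = 1

/-- Statement of `stub_chevalleyUnits`. -/
def ChevalleyUnits : Prop :=
  ∀ (K : Type) [Field K] [NumberField K] (M : ℕ), 0 < M →
    ∃ a : ℕ, 0 < a ∧ ∀ u : (𝓞 K)ˣ, (a : 𝓞 K) ∣ (u : 𝓞 K) - 1 → ∃ v : (𝓞 K)ˣ, u = v ^ M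

/-- Statement of `stub_weilExtension`. -/
def WeilExtension : Prop :=
  ∀ (K : Type) [Field K] [NumberField K] (m : InfinitePlace K → ℤ) (t : InfinitePlace K → ℝ)
    (a : ℕ), 0 < a →
    (∀ u : (𝓞 K)ˣ, (a : 𝓞 K) ∣ (u : 𝓞 K) - 1 →
      ∏ w : InfinitePlace K, archUnitaryValue (m w) (t w) (w.embedding ((u : 𝓞 K) : K)) = 1) →
    ∃ ψ : HeckeCharacter K, ψ.HasUnitaryArchType m t

/-- Statement of `stub_writeArchParam`. -/
def WriteArchParam : Prop :=
  ∀ (K : Type) [Field K] [NumberField K] [IsTotallyComplex K]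
    (h1 : isCompact_glFiniteIntegralLevel 1 K) (ψ : HeckeCharacter K)
    (m : InfinitePlace K → ℤ) (t : InfinitePlace K → ℝ), ψ.HasUnitaryArchType m t → ∀ (r : ℝ)
    (P : (K →+* ℂ) → ℂ),
    (∀ w : InfinitePlace K, P w.embedding = r + ((m w : ℂ) + t w * Complex.I) / 2) →
    (∀ w : InfinitePlace K, P (ComplexEmbedding.conjugate w.embedding) = r + (-(m w : ℂ) + t w * Complex.I) / 2) →
    ∃ χ : CuspidalAutomorphicRepData 1 K h1, χ.1.HasArchParameter (fun ι => {P ι})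

/-- **Weil EXISTENCE (finite-exponent form = Patrikis 2019 Lemma 2.1.1 (⇐) without the unitarity
clause)** — the kernel shared by every line on this crux; here DERIVED from stubs 2 + 3
(`weilExistence_of_chevalley_extension`), on the torsion-blind branch taken from the named fact
(`weilExistence_of_patrikis`). -/
def WeilExistence : Prop :=
  ∀ (K : Type) [Field K] [NumberField K] (m : InfinitePlace K → ℤ) (t : InfinitePlace K → ℝ),
    (∃ M : ℕ, 0 < M ∧ ∀ α : (𝓞 K)ˣ,
      (∏ w : InfinitePlace K, archUnitaryValue (m w) (t w) (w.embedding ((α : 𝓞 K) : K))) ^ M = 1) →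
    ∃ ψ : HeckeCharacter K, ψ.HasUnitaryArchType m t

/-- The accepted named fact `Chevalley1951.thm1_units` gives stub 2 in one line (sanity certificate of
the debt: stub 2 is Chevalley's theorem for the unit group WITHOUT the coprime-to-`N` refinement). -/
theorem chevalleyUnits_of_thm1_units
    (h : Literature.NumberTheory.NumberFields.Chevalley1951.thm1_units) : ChevalleyUnits := by
  intro K _ _ M hM
  obtain ⟨a, ha, -, h⟩ := h K M hM 1 Nat.one_pos
  exact ⟨a, ha, h⟩

/-- The torsion-blind branch: the named fact `Patrikis2019_heckeCharacter_archType_iff_units` (⇐) IS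
`WeilExistence` (with a unitary witness). -/
theorem weilExistence_of_patrikis (hW : Patrikis2019_heckeCharacter_archType_iff_units) :
    WeilExistence := fun K _ _ m t h =>
  ((hW K m t).mpr h).imp fun _ hψ => hψ.2

/-! ## §2 The lever: CM torsion blinds the angular exponents; the modulus exponent halves
(sorry-free; after `IdeaSketch3` of card torsion-blind-unit-criterion, re-proved here so that this
skeleton imports no sketch file) -/

section Blindness

variable (K : Type*) [Field K] [NumberField K] [IsCMField K]

/-- CM TORSION (Kronecker; Mathlib `IsCMField.unitsMulComplexConjInv : (𝓞 K)ˣ →* torsion K`): for a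
unit `α` of a CM field and ANY embedding `φ`, `φ α / conj (φ α) = φ (α ᾱ⁻¹)` is a root of unity of order
dividing `w_K = torsionOrder K`. -/
theorem embedding_div_conj_pow_torsionOrder (φ : K →+* ℂ) (α : (𝓞 K)ˣ) :
    ((φ ((α : 𝓞 K) : K)) / conj (φ ((α : 𝓞 K) : K))) ^ torsionOrder K = 1 := by
  have hζmem : ((IsCMField.unitsMulComplexConjInv K α : torsion K) : (𝓞 K)ˣ) ∈
      rootsOfUnity (torsionOrder K) (𝓞 K) := by
    rw [rootsOfUnity_eq_torsion]; exact Subtype.coe_prop _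
  have hζ : (((IsCMField.unitsMulComplexConjInv K α : torsion K) : (𝓞 K)ˣ)) ^ torsionOrder K = 1 :=
    (mem_rootsOfUnity _ _).mp hζmem
  have hconj : φ ((((IsCMField.unitsComplexConj K α : (𝓞 K)ˣ) : 𝓞 K) : K)) =
      conj (φ ((α : 𝓞 K) : K)) := by
    rw [← IsCMField.complexEmbedding_complexConj K φ]
    rfl
  have hval : ((Units.complexEmbedding φ
      ((IsCMField.unitsMulComplexConjInv K α : torsion K) : (𝓞 K)ˣ) : ℂˣ) : ℂ) =
      φ ((α : 𝓞 K) : K) / conj (φ ((α : 𝓞 K) : K)) := by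
    rw [IsCMField.unitsMulComplexConjInv_apply, map_mul, map_inv, Units.val_mul,
      Units.val_inv_eq_inv_val, Units.complexEmbedding_apply, Units.complexEmbedding_apply, hconj,
      div_eq_mul_inv]
  have h := congrArg (fun u : (𝓞 K)ˣ => ((Units.complexEmbedding φ u : ℂˣ) : ℂ)) hζ
  simp only [map_pow, map_one, Units.val_pow_eq_pow_val, Units.val_one] at h
  rwa [hval] at h

/-- BLINDNESS CORE: `(φ α / |φ α|)^(2 w_K) = 1` for every unit of a CM field, because
`(z/|z|)² = z / conj z`. -/
theorem embedding_div_norm_pow_eq_one (φ : K →+* ℂ) (α : (𝓞 K)ˣ) :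
    ((φ ((α : 𝓞 K) : K)) / (‖φ ((α : 𝓞 K) : K)‖ : ℂ)) ^ (2 * torsionOrder K) = 1 := by
  set z : ℂ := φ ((α : 𝓞 K) : K) with hz
  have hz0 : z ≠ 0 := by
    rw [hz, map_ne_zero]
    exact_mod_cast Units.ne_zero α
  have hsq : (z / (‖z‖ : ℂ)) ^ 2 = z / conj z := by
    have hn : (‖z‖ : ℂ) ≠ 0 := by exact_mod_cast (norm_ne_zero_iff.mpr hz0)
    have hc : conj z ≠ 0 := (map_ne_zero _).mpr hz0
    have hnorm : ((‖z‖ : ℂ)) ^ 2 = z * conj z := by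
      rw [Complex.mul_conj, Complex.normSq_eq_norm_sq]; push_cast; ring
    field_simp
    rw [hnorm]
    try ring
  rw [pow_mul, hsq]
  exact embedding_div_conj_pow_torsionOrder K φ α

/-- BLIND: on a CM unit Weil's local factor `(z/|z|)^m |z|^{it}` forgets `m` once raised to `2 w_K`. -/
theorem archUnitaryValue_unit_pow_blind (m : ℤ) (t : ℝ) (φ : K →+* ℂ) (α : (𝓞 K)ˣ) :
    archUnitaryValue m t (φ ((α : 𝓞 K) : K)) ^ (2 * torsionOrder K) =
      archUnitaryValue 0 t (φ ((α : 𝓞 K) : K)) ^ (2 * torsionOrder K) := by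
  unfold archUnitaryValue
  rw [mul_pow, mul_pow, zpow_zero, one_pow, one_mul, ← zpow_natCast (_ ^ m), ← zpow_mul, mul_comm m,
    zpow_mul, zpow_natCast, embedding_div_norm_pow_eq_one K φ α, one_zpow, one_mul]

end Blindness

/-- HALVE: `(|z|^{i t/2})² = |z|^{i t}` (principal power of a non-negative real). -/
theorem archUnitaryValue_zero_half_sq (t : ℝ) (z : ℂ) :
    archUnitaryValue 0 (t / 2) z ^ 2 = archUnitaryValue 0 t z := by
  unfold archUnitaryValue
  rw [zpow_zero, one_mul, one_mul, ← Complex.cpow_nat_mul]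
  congr 1
  push_cast; ring

/-- **Blind-and-halve transfer of Weil's unit hypothesis over a CM field**: if the unitary type `(m, t)`
has finite exponent on the units, so does `(m', t/2)` for EVERY `m'` (exponent `2 w_K · 2M`). -/
theorem weilHypothesis_blind_halve (K : Type*) [Field K] [NumberField K] [IsCMField K]
    (m m' : InfinitePlace K → ℤ) (t : InfinitePlace K → ℝ)
    (h : ∃ M : ℕ, 0 < M ∧ ∀ α : (𝓞 K)ˣ,
      (∏ w : InfinitePlace K, archUnitaryValue (m w) (t w) (w.embedding ((α : 𝓞 K) : K))) ^ M = 1) :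
    ∃ M' : ℕ, 0 < M' ∧ ∀ α : (𝓞 K)ˣ,
      (∏ w : InfinitePlace K,
        archUnitaryValue (m' w) (t w / 2) (w.embedding ((α : 𝓞 K) : K))) ^ M' = 1 := by
  obtain ⟨M, hM, hrel⟩ := h
  set n := torsionOrder K with hn
  refine ⟨2 * n * (2 * M), by have := torsionOrder_pos K; positivity, fun α => ?_⟩
  have key : ∀ (μ : InfinitePlace K → ℤ) (α : (𝓞 K)ˣ) (s : InfinitePlace K → ℝ),
      (∏ w : InfinitePlace K, archUnitaryValue (μ w) (s w) (w.embedding ((α : 𝓞 K) : K))) ^ (2 * n) =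
        (∏ w : InfinitePlace K, archUnitaryValue 0 (s w) (w.embedding ((α : 𝓞 K) : K))) ^ (2 * n) := by
    intro μ α s
    rw [← Finset.prod_pow, ← Finset.prod_pow]
    exact Finset.prod_congr rfl fun w _ => archUnitaryValue_unit_pow_blind K (μ w) (s w) w.embedding α
  calc (∏ w : InfinitePlace K, archUnitaryValue (m' w) (t w / 2) (w.embedding ((α : 𝓞 K) : K))) ^
          (2 * n * (2 * M))
      = ((∏ w : InfinitePlace K, archUnitaryValue 0 (t w / 2) (w.embedding ((α : 𝓞 K) : K))) ^
          (2 * n)) ^ (2 * M) := by rw [pow_mul, key]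
    _ = ((∏ w : InfinitePlace K, archUnitaryValue 0 (t w / 2) (w.embedding ((α : 𝓞 K) : K))) ^ 2) ^
          (2 * n * M) := by rw [← pow_mul, ← pow_mul]; congr 1; ring
    _ = (∏ w : InfinitePlace K, archUnitaryValue 0 (t w) (w.embedding ((α : 𝓞 K) : K))) ^
          (2 * n * M) := by
        rw [← Finset.prod_pow]
        congr 1
        exact Finset.prod_congr rfl fun w _ => archUnitaryValue_zero_half_sq (t w) _
    _ = ((∏ w : InfinitePlace K, archUnitaryValue 0 (t w) (w.embedding ((α : 𝓞 K) : K))) ^ (2 * n)) ^ M := by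
        rw [← pow_mul]
    _ = ((∏ w : InfinitePlace K, archUnitaryValue (m w) (t w) (w.embedding ((α : 𝓞 K) : K))) ^ (2 * n)) ^ M := by
        rw [key m α t]
    _ = ((∏ w : InfinitePlace K, archUnitaryValue (m w) (t w) (w.embedding ((α : 𝓞 K) : K))) ^ M) ^ (2 * n) := by
        rw [← pow_mul, ← pow_mul, mul_comm]
    _ = 1 := by rw [hrel α, one_pow]

/-- Inversion of Weil's local factor: `(m, t) ↦ (-m, -t)` inverts the value (for `z ≠ 0`). -/
theorem archUnitaryValue_neg_neg (m : ℤ) (t : ℝ) {z : ℂ} (hz : z ≠ 0) :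
    archUnitaryValue (-m) (-t) z = (archUnitaryValue m t z)⁻¹ := by
  unfold archUnitaryValue
  rw [zpow_neg, mul_inv]
  congr 1
  rw [← Complex.cpow_neg]
  congr 1
  push_cast; ring

/-- The blind-and-halve transfer with the SIGN the crux needs (`t ↦ -t/2`: the half twist carries
`Im (p σ_w + p σ̄_w) = -Im (e σ_w + e σ̄_w)/2`). -/
theorem weilHypothesis_blind_halve_neg (K : Type*) [Field K] [NumberField K] [IsCMField K]
    (m m' : InfinitePlace K → ℤ) (t : InfinitePlace K → ℝ)
    (h : ∃ M : ℕ, 0 < M ∧ ∀ α : (𝓞 K)ˣ,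
      (∏ w : InfinitePlace K, archUnitaryValue (m w) (t w) (w.embedding ((α : 𝓞 K) : K))) ^ M = 1) :
    ∃ M' : ℕ, 0 < M' ∧ ∀ α : (𝓞 K)ˣ,
      (∏ w : InfinitePlace K,
        archUnitaryValue (m' w) (-(t w) / 2) (w.embedding ((α : 𝓞 K) : K))) ^ M' = 1 := by
  have h' : ∃ M : ℕ, 0 < M ∧ ∀ α : (𝓞 K)ˣ,
      (∏ w : InfinitePlace K, archUnitaryValue (-m w) (-t w) (w.embedding ((α : 𝓞 K) : K))) ^ M = 1 := by
    obtain ⟨M, hM, hrel⟩ := h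
    refine ⟨M, hM, fun α => ?_⟩
    have hz : ∀ w : InfinitePlace K, w.embedding ((α : 𝓞 K) : K) ≠ 0 := fun w => by
      rw [map_ne_zero]; exact_mod_cast Units.ne_zero α
    rw [Finset.prod_congr rfl fun w _ => archUnitaryValue_neg_neg (m w) (t w) (hz w),
      Finset.prod_inv_distrib, inv_pow, hrel α, inv_one]
  simpa [neg_div] using weilHypothesis_blind_halve K (fun w => -m w) m' (fun w => -t w) h'

/-! ## §3 Saturation bookkeeping: Weil's unit product is a homomorphism in the unit (sorry-free) -/

/-- Weil's local factor is multiplicative (no hypotheses: `0/0 = 0`, `mul_zpow`, and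
`Complex.mul_cpow_ofReal_nonneg` hold unconditionally). -/
theorem archUnitaryValue_mul (m : ℤ) (t : ℝ) (z z' : ℂ) :
    archUnitaryValue m t (z * z') = archUnitaryValue m t z * archUnitaryValue m t z' := by
  unfold archUnitaryValue
  rw [norm_mul, Complex.ofReal_mul, Complex.mul_cpow_ofReal_nonneg (norm_nonneg _) (norm_nonneg _),
    mul_div_mul_comm, mul_zpow]
  ring

/-- Weil's local factor on powers. -/
theorem archUnitaryValue_pow (m : ℤ) (t : ℝ) (z : ℂ) (k : ℕ) :
    archUnitaryValue m t (z ^ k) = archUnitaryValue m t z ^ k := by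
  induction k with
  | zero => simp [archUnitaryValue]
  | succ k ih => rw [pow_succ, archUnitaryValue_mul, ih, pow_succ]

/-- Weil's unit product on a power of a unit. -/
theorem prod_archUnitaryValue_unit_pow {K : Type*} [Field K] [NumberField K]
    (m : InfinitePlace K → ℤ) (t : InfinitePlace K → ℝ) (v : (𝓞 K)ˣ) (k : ℕ) :
    (∏ w : InfinitePlace K, archUnitaryValue (m w) (t w) (w.embedding (((v ^ k : (𝓞 K)ˣ) : 𝓞 K) : K))) =
      (∏ w : InfinitePlace K, archUnitaryValue (m w) (t w) (w.embedding ((v : 𝓞 K) : K))) ^ k := by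
  rw [← Finset.prod_pow]
  refine Finset.prod_congr rfl fun w _ => ?_
  have hv : (((v ^ k : (𝓞 K)ˣ) : 𝓞 K) : K) = ((v : 𝓞 K) : K) ^ k := by
    rw [Units.val_pow_eq_pow_val]
    rfl
  rw [hv, map_pow, archUnitaryValue_pow]

/-- **The line's consumer: Chevalley (exponent `M`) + Tate seed ⟹ Weil existence.** A unitary type of
finite exponent `M` on all units is trivial on the congruence subgroup inside the `M`-th powers (stub 2),
hence is the type of a Hecke character (stub 3). Sorry-free. -/
theorem weilExistence_of_chevalley_extension (hC : ChevalleyUnits) (hE : WeilExtension) :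
    WeilExistence := by
  intro K _ _ m t h
  obtain ⟨M, hM, hrel⟩ := h
  obtain ⟨a, ha, hpow⟩ := hC K M hM
  refine hE K m t a ha fun u hu => ?_
  obtain ⟨v, rfl⟩ := hpow u hu
  rw [prod_archUnitaryValue_unit_pow, hrel v]

/-! ## §4 Bookkeeping: embeddings of a CM field come in conjugate pairs (sorry-free) -/

section PairBookkeeping

variable {K : Type} [Field K]

theorem conjugate_conjugate' (ι : K →+* ℂ) : conjugate (conjugate ι) = ι :=
  RingHom.ext fun x => by simp

theorem mk_embedding_cases (ι : K →+* ℂ) :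
    (InfinitePlace.mk ι).embedding = ι ∨ (InfinitePlace.mk ι).embedding = conjugate ι := by
  rcases InfinitePlace.mk_eq_iff.mp (InfinitePlace.mk_embedding (InfinitePlace.mk ι)) with h | h
  · exact Or.inl h
  · right
    have h' := congrArg conjugate h
    rw [conjugate_conjugate'] at h'
    exact h'

variable [NumberField K]

/-- Over a CM (hence totally complex) field no embedding is its own conjugate. -/
theorem conjugate_ne_self [IsCMField K] (ι : K →+* ℂ) : conjugate ι ≠ ι := by
  intro h
  have hreal : ComplexEmbedding.IsReal ι := ComplexEmbedding.isReal_iff.mpr h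
  have h1 : (InfinitePlace.mk ι).IsReal := isReal_mk_iff.mpr hreal
  have h2 : (InfinitePlace.mk ι).IsComplex := NumberField.IsTotallyComplex.isComplex _
  exact (not_isReal_iff_isComplex.mpr h2) h1

/-- The flattening integers: the whole correction `j` sits on ONE embedding of each conjugate pair;
`N ι + N ῑ = j ι` whenever `j` is conjugation-symmetric (cf. Disproof F9: the shifts must depend on `ι`). -/
theorem flatten_pair [IsCMField K] (j : (K →+* ℂ) → ℤ) (hj : ∀ ι, j (conjugate ι) = j ι) (ι : K →+* ℂ) :
    ((if (InfinitePlace.mk ι).embedding = ι then j ι else 0 : ℤ) : ℂ) +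
      ((if (InfinitePlace.mk (conjugate ι)).embedding = conjugate ι then j (conjugate ι) else 0 : ℤ) : ℂ) =
        j ι := by
  have hne := conjugate_ne_self ι
  rw [InfinitePlace.mk_conjugate_eq]
  rcases mk_embedding_cases ι with h | h
  · rw [if_pos h, if_neg (by rw [h]; exact hne.symm)]
    push_cast; ring
  · rw [if_neg (by rw [h]; exact hne), if_pos h, hj]
    push_cast; ring

end PairBookkeeping

/-! ## §5 The composition (sorry-free): READ → blind-and-halve → Weil existence → WRITE -/

/-- **The crux from READ, Weil existence and WRITE** (exponent bookkeeping, kernel-checked). With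
`e = s₁ + s₂`: (T) for `e` is `stub_unitRelation`; the half type `(n, -T/2)` — `n_w = p σ_w - p σ̄_w`
integral by (ii), `T_w = Im (e σ_w + e σ̄_w)` — has finite exponent by the CM lever (§2); Weil existence
gives `ψ`; `Re (p σ_w + p σ̄_w) = 1 - σ` is place-independent by `exists_re_archParam_parallel_glOne`
(landed); WRITE with `r = (1 - σ)/2` returns the datum; `p ι + s₁ ι - ½ = N ι ∈ ℤ`. Hypothesis (i) unused. -/
theorem crux_of_weilExistence (hR : UnitRelation) (hW : WeilExistence) (hD : WriteArchParam) : Crux := by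
  intro K _ _ hK h1 s₁ s₂ _hi hii hiii hiv
  haveI : IsCMField K := hK
  obtain ⟨ω, hω⟩ := hiv
  -- the exponents of `ω`
  set e : (K →+* ℂ) → ℂ := fun ι => s₁ ι + s₂ ι with he
  have hωe : ω.1.HasArchParameter (fun ι => {e ι}) := hω
  -- angular integers of `ω` (landed: `archParam_embedding_sub_conj_mem_int_glOne`; (i) not needed)
  have hme' : ∀ w : InfinitePlace K, ∃ m : ℤ, e w.embedding - e (conjugate w.embedding) = m := by
    intro w
    obtain ⟨p, q, m, hp, hq, hpq⟩ := archParam_embedding_sub_conj_mem_int_glOne ω.1 hωe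
      ⟨w, NumberField.IsTotallyComplex.isComplex w⟩
    have hp' : e w.embedding = p := Multiset.singleton_inj.mp hp
    have hq' : e (conjugate w.embedding) = q := Multiset.singleton_inj.mp hq
    exact ⟨m, by rw [hp', hq', hpq]⟩
  choose me hme using hme'
  -- real weights are parallel (landed: `exists_re_archParam_parallel_glOne`)
  obtain ⟨σ, -, hpar⟩ := exists_re_archParam_parallel_glOne ω.1 hωe
  have hRe : ∀ w : InfinitePlace K, (e w.embedding + e (conjugate w.embedding)).re = 2 * σ :=
    fun w => hpar ⟨w, NumberField.IsTotallyComplex.isComplex w⟩ _ _ rfl rfl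
  -- imaginary weights
  set T : InfinitePlace K → ℝ := fun w => (e w.embedding + e (conjugate w.embedding)).im with hT
  have hsum : ∀ w : InfinitePlace K,
      e w.embedding + e (conjugate w.embedding) = ((2 * σ : ℝ) : ℂ) + (T w : ℂ) * Complex.I := by
    intro w
    have h := (Complex.re_add_im (e w.embedding + e (conjugate w.embedding))).symm
    rw [hRe w] at h
    exact h
  -- READ: Weil's unit relation for the type `(me, T)` of `ω`
  obtain ⟨M₀, hM₀, hrel⟩ := hR K h1 ω e hωe me hme
  -- the flattening integers from (iii)
  choose j hj using hiii
  have hj_symm : ∀ ι, j (conjugate ι) = j ι := by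
    intro ι
    have h1' := hj ι
    have h2' := hj (conjugate ι)
    rw [conjugate_conjugate'] at h2'
    have : (2 : ℂ) * (j (conjugate ι) : ℂ) = 2 * (j ι : ℂ) := by rw [← h1', ← h2']; ring
    exact_mod_cast (mul_right_injective₀ (two_ne_zero' ℂ) this)
  set N : (K →+* ℂ) → ℤ := fun ι => if (InfinitePlace.mk ι).embedding = ι then j ι else 0 with hN
  have hNpair : ∀ ι, (N ι : ℂ) + N (conjugate ι) = j ι := fun ι => flatten_pair j hj_symm ι
  -- the exponents of the half twist
  set p : (K →+* ℂ) → ℂ := fun ι => 1 / 2 - s₁ ι + N ι with hp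
  have key : ∀ ι, (2 : ℂ) * (p ι + p (conjugate ι)) = 2 - (e ι + e (conjugate ι)) := by
    intro ι
    have h3 := hj ι
    have h4 := hNpair ι
    simp only [hp, he]
    linear_combination (-1 : ℂ) * h3 + 2 * h4
  -- angular integers of the half twist, from (ii)
  choose mii hmii using hii
  set n : InfinitePlace K → ℤ := fun w => -mii w.embedding + N w.embedding - N (conjugate w.embedding)
    with hn
  have hnw : ∀ w : InfinitePlace K, p w.embedding - p (conjugate w.embedding) = n w := by
    intro w
    have h := hmii w.embedding
    simp only [hp, hn]
    push_cast
    linear_combination (-1 : ℂ) * h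
  -- THE LEVER: the half type `(n, -T/2)` has finite exponent on all units (CM blindness + halving)
  obtain ⟨M₁, hM₁, hhalf⟩ := weilHypothesis_blind_halve_neg K me n T ⟨M₀, hM₀, hrel⟩
  -- Weil existence (Chevalley + Tate seed on this line)
  obtain ⟨ψ, hψ⟩ := hW K n (fun w => -(T w) / 2) ⟨M₁, hM₁, hhalf⟩
  -- WRITE with real weight `(1 - σ)/2`
  have hPw : ∀ w : InfinitePlace K,
      p w.embedding = (((1 - σ) / 2 : ℝ) : ℂ) + ((n w : ℂ) + ((-(T w) / 2 : ℝ) : ℂ) * Complex.I) / 2 := by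
    intro w
    have hk := key w.embedding
    have hd := hnw w
    have hs := hsum w
    push_cast at hs ⊢
    linear_combination (1 / 4 : ℂ) * hk + (1 / 2 : ℂ) * hd - (1 / 4 : ℂ) * hs
  have hPw' : ∀ w : InfinitePlace K,
      p (conjugate w.embedding) =
        (((1 - σ) / 2 : ℝ) : ℂ) + (-(n w : ℂ) + ((-(T w) / 2 : ℝ) : ℂ) * Complex.I) / 2 := by
    intro w
    have hk := key w.embedding
    have hd := hnw w
    have hs := hsum w
    push_cast at hs ⊢
    linear_combination (1 / 4 : ℂ) * hk - (1 / 2 : ℂ) * hd - (1 / 4 : ℂ) * hs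
  obtain ⟨χ, hχ⟩ := hD K h1 ψ n (fun w => -(T w) / 2) hψ ((1 - σ) / 2) p hPw hPw'
  exact ⟨χ, p, hχ, fun ι => ⟨N ι, by simp only [hp]; ring⟩⟩

/-- **The crux from the four stubs** (sorry-free composition; axioms `propext, Classical.choice,
Quot.sound`). -/
theorem crux_of_stubs (h₁ : UnitRelation) (h₂ : ChevalleyUnits) (h₃ : WeilExtension)
    (h₄ : WriteArchParam) : Crux :=
  crux_of_weilExistence h₁ (weilExistence_of_chevalley_extension h₂ h₃) h₄

/-- **THE SKELETON THEOREM — concludes the crux BY NAME from the registered stubs** (the only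
`sorry`s of this file sit inside `stub_unitRelation`, `stub_chevalleyUnits`, `stub_weilExtension`,
`stub_writeArchParam`). -/
theorem HalfIntegralTwistCM_of :
    Summit.Langlands.Langlands.Theses.IrreducibilityBySelfDuality.HalfIntegralTwistCM :=
  crux_of_stubs stub_unitRelation stub_chevalleyUnits stub_weilExtension stub_writeArchParam

end Summit.Langlands.Langlands.Cruxes.HalfIntegralTwistCM.ChevalleyExponentSaturation

end
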